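import Summits.Ventures.HodgeRepro2.T5SU11GaussLegendreError
import Summits.Ventures.HodgeRepro2.T5SU11ChristoffelFunction
import Summits.Ventures.HodgeRepro2.T5SU11SphericalLegendreCorollaries
import Summits.Ventures.HodgeRepro2.T5SU11LegendreZeroBounds
import Summits.Ventures.HodgeRepro2.T5SU11GaussLegendreSymmetry
import Summits.Ventures.HodgeRepro2.T5SU11LegendreDerivativeBound

/-!
# The Legendre chapter, part IV, in one place: rows 406–416 indexed under uniform names

A fourth summary module (the first three cover rows 363–405): the headline statements of rows 406–416 restated and
proved by reference — orthogonality to lower degrees (406), Gauss–Legendre quadrature with positive weights (408),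
the Legendre expansion with Parseval and the reproducing kernel (409), the Christoffel weights in closed form and the
discrete orthogonality (410), the group consequences (411), the localisation of the zeros (412), the quadrature error
at degree `2n` (413), the Christoffel function as an extremal value (414), the symmetry of the rule (415) and Markov's
bound for all derivatives (416). Nothing is claimed about (N).

Blind lane: Mathlib + the HodgeRepro2 prefix only; no sorry; axioms ⊆ {propext, Classical.choice,
Quot.sound}.
-/

namespace Summit.Ventures.HodgeRepro2.T5SU11LegendreSummaryIV

open MeasureTheory Metric Set Filter Topology Finset Polynomial intervalIntegral
open T5SU11Unimodular T5SU11Cartan T5SU11SphericalFunction T5SU11SphericalLegendreAll T5SU11JacobiPhaseLawEven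
  T5SU11JacobiLegendreLeading T5SU11LegendreOrthogonalLower T5SU11GaussLegendre T5SU11LegendreExpansion
  T5SU11GaussLegendreWeights T5SU11SphericalLegendreCorollaries T5SU11LegendreZeroBounds T5SU11GaussLegendreError
  T5SU11ChristoffelFunction T5SU11GaussLegendreSymmetry T5SU11LegendreDerivativeBound T5SU11LegendreTuran
open scoped Real

/-- 406: **`P_n ⊥` every polynomial of degree `< n`**. -/
theorem orthogonal_lower {n : ℕ} {q : ℝ[X]} (hq : q.natDegree < n) :
    ∫ x in (-1 : ℝ)..1, q.eval x * legP n x = 0 :=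
  integral_eval_mul_legP_eq_zero_of_natDegree_lt hq

/-- 406: every polynomial of degree `≤ d` is a combination of `P_0, …, P_d`. -/
theorem span (d : ℕ) (q : ℝ[X]) (hq : q.natDegree ≤ d) : ∃ c : ℕ → ℝ, q = ∑ k ∈ range (d + 1), C (c k) * legPoly k :=
  exists_eq_sum_C_mul_legPoly d q hq

/-- 408: **Gauss–Legendre quadrature**, packaged: an `n`-element node set `s ⊂ (−1, 1)` (the zeros of `P_n`) with
positive weights summing to `2`, exact for every polynomial of degree `≤ 2n − 1`. -/
theorem gauss_legendre_rule {n : ℕ} (hn : 1 ≤ n) :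
    ∃ s : Finset ℝ, s.card = n ∧ (∀ r ∈ s, r ∈ Ioo (-1 : ℝ) 1) ∧ (∀ r ∈ s, legP n r = 0)
      ∧ (∀ i ∈ s, 0 < weight s i) ∧ ∑ i ∈ s, weight s i = 2
      ∧ ∀ f : ℝ[X], f.natDegree ≤ 2 * n - 1 → ∫ x in (-1 : ℝ)..1, f.eval x = ∑ i ∈ s, weight s i * f.eval i :=
  exists_gauss_legendre_rule hn

/-- 408: the rule for the zero set `s` of `P_n`. -/
theorem gauss_legendre_exact {n : ℕ} (hn : 1 ≤ n) {s : Finset ℝ} (hcard : s.card = n) (hs : ∀ r ∈ s, legP n r = 0)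
    {f : ℝ[X]} (hf : f.natDegree ≤ 2 * n - 1) :
    ∫ x in (-1 : ℝ)..1, f.eval x = ∑ i ∈ s, weight s i * f.eval i :=
  gauss_legendre hn hcard hs hf

/-- 409: **the Legendre expansion** `f = Σ_{k ≤ d} c_k(f) P_k`. -/
theorem legendre_expansion {d : ℕ} {f : ℝ[X]} (hf : f.natDegree ≤ d) :
    f = ∑ k ∈ range (d + 1), C (legendreCoeff f k) * legPoly k :=
  eq_sum_legendreCoeff hf

/-- 409: **Parseval** `∫ f² = Σ_{k ≤ d} 2 c_k(f)²/(2k + 1)`. -/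
theorem parseval {d : ℕ} {f : ℝ[X]} (hf : f.natDegree ≤ d) :
    ∫ x in (-1 : ℝ)..1, f.eval x ^ 2 = ∑ k ∈ range (d + 1), legendreCoeff f k ^ 2 * (2 / (2 * (k : ℝ) + 1)) :=
  integral_sq_eq_sum hf

/-- 409: the reproducing kernel, `∫ K_d(x, y) f(y) dy = f(x)`. -/
theorem reproducing {d : ℕ} {f : ℝ[X]} (hf : f.natDegree ≤ d) (x : ℝ) :
    ∫ y in (-1 : ℝ)..1, kernel d x y * f.eval y = f.eval x :=
  integral_kernel_mul_eq hf x

/-- 410: **the classical weights** `w_i = 2/((1 − x_i²) P'_{n+1}(x_i)²)`. -/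
theorem weights_classical {n : ℕ} {s : Finset ℝ} (hcard : s.card = n + 1) (hs : ∀ r ∈ s, legP (n + 1) r = 0)
    {i : ℝ} (hi : i ∈ s) : weight s i = 2 / ((1 - i ^ 2) * legQ (n + 1) i ^ 2) :=
  weight_eq_classical hcard hs hi

/-- 410: the Christoffel numbers `w_i = 2/Σ_{k ≤ n} (2k + 1) P_k(x_i)²`. -/
theorem weights_christoffel {n : ℕ} {s : Finset ℝ} (hcard : s.card = n + 1) (hs : ∀ r ∈ s, legP (n + 1) r = 0)
    {i : ℝ} (hi : i ∈ s) : weight s i = 2 / ∑ k ∈ range (n + 1), (2 * (k : ℝ) + 1) * legP k i ^ 2 :=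
  weight_eq_two_div_sum hcard hs hi

/-- 410: discrete orthogonality `Σ_i w_i P_k(x_i) P_l(x_i) = 2δ_{kl}/(2k + 1)` for `k, l ≤ n`. -/
theorem discrete_orthogonality {n : ℕ} {s : Finset ℝ} (hcard : s.card = n + 1)
    (hs : ∀ r ∈ s, legP (n + 1) r = 0) {k l : ℕ} (hk : k ≤ n) (hl : l ≤ n) :
    ∑ i ∈ s, weight s i * (legP k i * legP l i) = if k = l then 2 / (2 * (k : ℝ) + 1) else 0 :=
  sum_weight_mul_legP_mul_legP hcard hs hk hl

/-- 412: **every zero of `P_n` has `|r| ≤ 1 − 2/(n(n + 1))`**. -/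
theorem zero_bound {n : ℕ} (hn : 1 ≤ n) {r : ℝ} (hr : legP n r = 0) : |r| ≤ 1 - 2 / ((n : ℝ) * (n + 1)) :=
  abs_root_le hn hr

/-- 412: the largest zero of `P_n` is `≥ 1/√3` for `n ≥ 2`. -/
theorem largest_zero_ge {n : ℕ} (hn : 2 ≤ n) : ∃ r, legP n r = 0 ∧ 1 / Real.sqrt 3 ≤ r :=
  exists_root_ge hn

/-- 413: **the quadrature error at degree `2n`**,
`∫ f − Σ_i w_i f(x_i) = (coeff f (2n)) · 2^{2n+1} (n!)⁴/((2n + 1) ((2n)!)²)`. -/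
theorem quadrature_error {n : ℕ} (hn : 1 ≤ n) {s : Finset ℝ} (hcard : s.card = n) (hs : ∀ r ∈ s, legP n r = 0)
    {f : ℝ[X]} (hf : f.natDegree ≤ 2 * n) :
    (∫ x in (-1 : ℝ)..1, f.eval x) - ∑ i ∈ s, weight s i * f.eval i
      = f.coeff (2 * n) * (2 ^ (2 * n + 1) * ((n.factorial : ℝ)) ^ 4 / ((2 * (n : ℝ) + 1) * ((2 * n).factorial : ℝ) ^ 2)) :=
  gauss_legendre_error' hn hcard hs hf

/-- 413: the exactness degree `2n − 1` is sharp. -/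
theorem quadrature_error_ne_zero {n : ℕ} (hn : 1 ≤ n) {s : Finset ℝ} (hcard : s.card = n)
    (hs : ∀ r ∈ s, legP n r = 0) {f : ℝ[X]} (hf : f.natDegree = 2 * n) (hf0 : f ≠ 0) :
    (∫ x in (-1 : ℝ)..1, f.eval x) - ∑ i ∈ s, weight s i * f.eval i ≠ 0 :=
  gauss_legendre_error_ne_zero hn hcard hs hf hf0

/-- 414: **the Christoffel function** `λ_n(x) = 1/K_n(x, x) = min { ∫ p² : deg p ≤ n, p(x) = 1 }`. -/
theorem christoffel_function_min (n : ℕ) (x : ℝ) :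
    (∀ p : ℝ[X], p.natDegree ≤ n → p.eval x = 1 → christoffelFun n x ≤ ∫ y in (-1 : ℝ)..1, p.eval y ^ 2)
      ∧ ∃ p : ℝ[X], p.natDegree ≤ n ∧ p.eval x = 1 ∧ ∫ y in (-1 : ℝ)..1, p.eval y ^ 2 = christoffelFun n x :=
  christoffelFun_eq_min n x

/-- 414: the Gauss–Legendre weights are minima, `w_i ≤ ∫ p²` for `deg p ≤ n`, `p(x_i) = 1`. -/
theorem weight_variational {n : ℕ} {s : Finset ℝ} (hcard : s.card = n + 1) (hs : ∀ r ∈ s, legP (n + 1) r = 0)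
    {i : ℝ} (hi : i ∈ s) {p : ℝ[X]} (hp : p.natDegree ≤ n) (hpi : p.eval i = 1) :
    weight s i ≤ ∫ y in (-1 : ℝ)..1, p.eval y ^ 2 :=
  weight_le_integral_sq hcard hs hi hp hpi

/-- 415: **the rule is symmetric**: `−s = s` and `w_{−x_i} = w_{x_i}`. -/
theorem symmetric {n : ℕ} {s : Finset ℝ} (hcard : s.card = n) (hs : ∀ r ∈ s, legP n r = 0) :
    s.image (fun x : ℝ => -x) = s ∧ ∀ i ∈ s, weight s (-i) = weight s i :=
  gauss_legendre_symmetric hcard hs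

/-- 415: `0` is a node iff `n` is odd. -/
theorem zero_node_iff_odd {n : ℕ} {s : Finset ℝ} (hcard : s.card = n) (hs : ∀ r ∈ s, legP n r = 0) :
    (0 : ℝ) ∈ s ↔ Odd n :=
  zero_mem_iff_odd hcard hs

/-- 416: **Markov's bound for all derivatives**, `|P_n^{(k)}(x)| ≤ P_n^{(k)}(1)` on `[−1, 1]`. -/
theorem markov_all_derivatives (n k : ℕ) {x : ℝ} (hx : x ∈ Icc (-1 : ℝ) 1) :
    |(legD n k).eval x| ≤ (legD n k).eval 1 :=
  abs_eval_legD_le n k hx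

/-- 416: every derivative of `P_n` is a positive combination of Legendre polynomials. -/
theorem derivative_posComb (n k : ℕ) : IsPosComb (legD n k) :=
  isPosComb_legD n k

/-- 414: Cauchy–Schwarz on `[−1, 1]`. -/
theorem cauchy_schwarz {g h : ℝ → ℝ} (hg : Continuous g) (hh : Continuous h) :
    (∫ x in (-1 : ℝ)..1, g x * h x) ^ 2 ≤ (∫ x in (-1 : ℝ)..1, g x ^ 2) * ∫ x in (-1 : ℝ)..1, h x ^ 2 :=
  integral_mul_sq_le hg hh

section measure

variable [MeasurableSpace Circle] [BorelSpace Circle]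

/-- 411: **`φ_{2n+2}(g) ≠ 0`** for every `g`. -/
theorem sph_even_nonvanishing (n : ℕ) (g : SU11) : sph (2 * (n : ℝ) + 2) g ≠ 0 :=
  sph_even_ne_zero n g

/-- 411: `φ_{2n+2}(a_t) ≥ 1 + n(n + 1)(cosh(2t) − 1)/2` for `t ≥ 0`. -/
theorem sph_even_growth (n : ℕ) {t : ℝ} (ht : 0 ≤ t) :
    1 + (n : ℝ) * (n + 1) * (Real.cosh (2 * t) - 1) / 2 ≤ sph (2 * (n : ℝ) + 2) (hyp t) :=
  sph_even_hyp_ge n ht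

/-- 411: every polynomial in `φ_4` is a finite combination of the `φ_{2k+2}`. -/
theorem polynomial_in_sph_four {d : ℕ} {f : ℝ[X]} (hf : f.natDegree ≤ d) (g : SU11) :
    f.eval (sph 4 g) = ∑ k ∈ range (d + 1), legendreCoeff f k * sph (2 * (k : ℝ) + 2) g :=
  eval_sph_four_eq_sum hf g

end measure

end Summit.Ventures.HodgeRepro2.T5SU11LegendreSummaryIV
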